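/-
Copyright: lit-balaban cell (HOME `run/shared/lean/pub/lit-balaban/`), Phase-2 proof seat p12 (gen 7).  The proofs reproduce the
printed arguments; nothing is claimed beyond what the kernel checks below.
-/
import Literature.MathematicalPhysics.QuantumFieldTheory.DybalskiStottmeisterTanimoto2024.DST24RemainderFormula
import Literature.MathematicalPhysics.QuantumFieldTheory.DybalskiStottmeisterTanimoto2024.DST24LaplacianBounds

/-!
# `DybalskiStottmeisterTanimoto2024.DST24RemainderBounds` — [DybalskiStottmeisterTanimoto2024] **§4.6 Lemma (r-lemma-one)** PROVED:
# `|r⃗(b)| ≤ 6(ε² + ε₁)` and `‖∂*r⃗‖_{∞;Ω} ≤ 24(ε² + ε₁)`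

statement-level skeleton of published theorems with citation tags; proofs where landed; nothing here is a claim about
the Yang–Mills mass gap

W. Dybalski, A. Stottmeister, Y. Tanimoto, *The Bałaban variational problem in the non-linear sigma model*, Rev. Math. Phys.
**36** (2024), arXiv:2403.09800; source held `paper:arxiv-2403.09800` (§4.6 = tex chunks p0016–p0017).  Unit `lit-balaban-p12`
(gen 7); `rvec_formula` ((terms), corrected signs — the bounds below are term-wise absolute bounds and hold for either sign pattern)
from `DST24RemainderFormula`, the fibre counts `card_src_fiber_le`/`card_tgt_fiber_le` from `DST24LaplacianBounds`.

WHAT IS PRINTED (§4.6) AND PROVED HERE.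
* (first-delta-estimate) «`δ(A₀B₀) ≤ ε² + ε₁²`» (from (3.23)) — `delta_le`.
* Lemma (r-lemma-one) «Suppose that `|V⃗(b)| ≤ ε₁`, `A⃗ ∈ Conf⃗^ε(Ω)`, `δ = 1` and `0 ≤ ε, ε₁ ≤ 1/2`.  Then `‖∂*r⃗‖_{∞;Ω} ≤ 24(ε² + ε₁)`»,
  with its proof's intermediate (4.58) «`|r⃗(x,x′)| ≤ 2(ε² + ε₁²)ε + ε₁ + 2ε₁ε + ε² + 3ε²ε₁ ≤ 6(ε² + ε₁)`» and (lap-2) «`(∂*r⃗)(x) =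
  −r⃗(x,x+e₀) − r⃗(x,x+e₁) + r⃗(x−e₀,x) + r⃗(x−e₁,x)`, possibly with some terms omitted» (at most four terms) —
  `norm_rvec_le`, `norm_delStar_le_four_mul`, `r_lemma_one`.  (`δ = 1` for `V = ∂V(y_b)` is the hypothesis `hV0`.)
-/

namespace Literature.MathematicalPhysics.QuantumFieldTheory.DybalskiStottmeisterTanimoto2024.DST24RemainderBounds

open scoped Quaternion RealInnerProductSpace BigOperators
open Literature.MathematicalPhysics.QuantumFieldTheory.Federbush1986
open Literature.MathematicalPhysics.QuantumFieldTheory.DybalskiStottmeisterTanimoto2024.DST24Setting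
open Literature.MathematicalPhysics.QuantumFieldTheory.DybalskiStottmeisterTanimoto2024.DST24Configurations
open Literature.MathematicalPhysics.QuantumFieldTheory.DybalskiStottmeisterTanimoto2024.DST24LinearConstraint
open Literature.MathematicalPhysics.QuantumFieldTheory.DybalskiStottmeisterTanimoto2024.DST24TangentSpace
open Literature.MathematicalPhysics.QuantumFieldTheory.DybalskiStottmeisterTanimoto2024.DST24CriticalPoint
open Literature.MathematicalPhysics.QuantumFieldTheory.DybalskiStottmeisterTanimoto2024.DST24RemainderFormula
open Literature.MathematicalPhysics.QuantumFieldTheory.DybalskiStottmeisterTanimoto2024.DST24LaplacianBounds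

noncomputable section

variable {L n₁ : ℕ}

/-! ## Elementary norm bounds on `Im ℍ ≅ ℝ³` -/

/-- `|A⃗ × v⃗| ≤ |A⃗||v⃗|`. [cite: DybalskiStottmeisterTanimoto2024, §4.6 proof of Lemma (r-lemma-one) (term-wise bounds)] -/
theorem norm_crossLin_le (A v : su2) : ‖crossLin A v‖ ≤ ‖A‖ * ‖v‖ := by
  rw [← su2.norm_coe, crossLin_coe, ← su2.norm_coe, ← su2.norm_coe]
  exact (SU2.norm_im_le _).trans (norm_mul_le _ _)

/-- `|Re q| ≤ 1` on `SU(2)`. [cite: DybalskiStottmeisterTanimoto2024, §1.1 (Pauli-matrices-decomposition) («`A₀ = √(1 − |A⃗|²)`»)] -/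
theorem abs_re_le_one (q : SU2) : |q.val.re| ≤ 1 :=
  abs_le.mpr ⟨SU2.neg_one_le_re q, SU2.re_le_one q⟩

/-- `∂V(y_b)` is a unit quaternion (value of `V(y_{b₋})V(y_{b₊})⁻¹ ∈ SU(2)`). [cite: DybalskiStottmeisterTanimoto2024, §2.1 («`∂V(y_b) := V(y_{b₋})V(y_{b₊})*`»)] -/
theorem pdV_eq_val (V : CConf n₁) (b : Bond L n₁) : pdV V b = (V (blk b.src) * (V (blk b.tgt))⁻¹).val := rfl

/-- (first-delta-estimate) «`δ(A₀B₀) ≤ ε² + ε₁²`»: for unit quaternions with `δ = 1`, `1 − u₀v₀ ≤ |U⃗|² + |V⃗|²` (from (3.23)).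
[cite: DybalskiStottmeisterTanimoto2024, §3.4 (3.23); §4.6 (first-delta-estimate)] -/
theorem delta_le (u v : SU2) (hu : 0 ≤ u.val.re) (hv : 0 ≤ v.val.re) :
    1 - u.val.re * v.val.re ≤ ‖vecOf u.val‖ ^ 2 + ‖vecOf v.val‖ ^ 2 := by
  have h1 : ‖vecOf u.val‖ ^ 2 = 1 - u.val.re ^ 2 := by rw [norm_vecOf, SU2.norm_im_sq]
  have h2 : ‖vecOf v.val‖ ^ 2 = 1 - v.val.re ^ 2 := by rw [norm_vecOf, SU2.norm_im_sq]
  have hu1 := SU2.re_le_one u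
  have hv1 := SU2.re_le_one v
  nlinarith [mul_nonneg hu hv, mul_le_mul hu1 hv1 hv zero_le_one]

/-! ## (4.58): `|r⃗(b)| ≤ 6(ε² + ε₁)` -/

/-- (4.58) «`|r⃗(x,x′)| ≤ (|A⃗(x)|² + |V⃗|²)|A⃗(x′)| + (|A⃗(x′)|² + |V⃗|²)|A⃗(x)| + |V⃗| + |V⃗|(|A⃗(x)| + |A⃗(x′)|) + |A⃗(x)||A⃗(x′)| +
3|A⃗(x′)||A⃗(x)||V⃗| ≤ 2(ε² + ε₁²)ε + ε₁ + 2ε₁ε + ε² + 3ε²ε₁ ≤ 6(ε² + ε₁)`» — term-wise from (terms).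
[cite: DybalskiStottmeisterTanimoto2024, §4.6 proof of Lemma (r-lemma-one), (4.58)] -/
theorem norm_rvec_le {ε ε₁ : ℝ} (hε : 0 ≤ ε) (hε' : ε ≤ 1 / 2) (hε₁ : 0 ≤ ε₁) (hε₁' : ε₁ ≤ 1 / 2) {U' : Conf L n₁}
    (hA : ∀ x, ‖Avec U' x‖ ≤ ε) (hδ : ∀ x, 0 ≤ (U' x).val.re) {V : CConf n₁} (hV : ∀ b : Bond L n₁, ‖vecOf (pdV V b)‖ ≤ ε₁)
    (hV0 : ∀ b : Bond L n₁, 0 ≤ (pdV V b).re) (b : Bond L n₁) : ‖rvec U' V b‖ ≤ 6 * (ε ^ 2 + ε₁) := by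
  rw [rvec_formula]
  set U := Avec U' b.src
  set Z := Avec U' b.tgt
  set Vv := vecOf (pdV V b)
  set u0 := (U' b.src).val.re
  set z0 := (U' b.tgt).val.re
  set v0 := (pdV V b).re
  have hu : ‖U‖ ≤ ε := hA b.src
  have hz : ‖Z‖ ≤ ε := hA b.tgt
  have hv : ‖Vv‖ ≤ ε₁ := hV b
  have hU0 := norm_nonneg U
  have hZ0 := norm_nonneg Z
  have hV00 := norm_nonneg Vv
  have hu0 : |u0| ≤ 1 := abs_re_le_one (U' b.src)
  have hz0 : |z0| ≤ 1 := abs_re_le_one (U' b.tgt)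
  have hv0 : |v0| ≤ 1 := by
    have := abs_re_le_one (V (blk b.src) * (V (blk b.tgt))⁻¹)
    rwa [← pdV_eq_val] at this
  -- the nine terms
  have t1 : ‖(1 - u0 * v0) • Z‖ ≤ (‖U‖ ^ 2 + ‖Vv‖ ^ 2) * ‖Z‖ := by
    rw [norm_smul]
    refine mul_le_mul_of_nonneg_right ?_ hZ0
    have hd := delta_le (U' b.src) (V (blk b.src) * (V (blk b.tgt))⁻¹) (hδ b.src) (by rw [← pdV_eq_val]; exact hV0 b)
    rw [← pdV_eq_val] at hd
    have hnn : 0 ≤ 1 - u0 * v0 := by nlinarith [abs_le.mp hu0, abs_le.mp hv0, abs_nonneg u0, abs_mul_abs_self u0]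
    rw [Real.norm_of_nonneg hnn]
    exact hd
  have t2 : ‖(1 - z0 * v0) • U‖ ≤ (‖Z‖ ^ 2 + ‖Vv‖ ^ 2) * ‖U‖ := by
    rw [norm_smul]
    refine mul_le_mul_of_nonneg_right ?_ hU0
    have hd := delta_le (U' b.tgt) (V (blk b.src) * (V (blk b.tgt))⁻¹) (hδ b.tgt) (by rw [← pdV_eq_val]; exact hV0 b)
    rw [← pdV_eq_val] at hd
    have hnn : 0 ≤ 1 - z0 * v0 := by nlinarith [abs_le.mp hz0, abs_le.mp hv0]
    rw [Real.norm_of_nonneg hnn]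
    exact hd
  have t3 : ‖(z0 * u0) • Vv‖ ≤ ‖Vv‖ := by
    rw [norm_smul, Real.norm_eq_abs, abs_mul]
    calc |z0| * |u0| * ‖Vv‖ ≤ 1 * 1 * ‖Vv‖ := by gcongr
      _ = ‖Vv‖ := by ring
  have t4 : ‖z0 • crossLin U Vv‖ ≤ ‖U‖ * ‖Vv‖ := by
    rw [norm_smul, Real.norm_eq_abs]
    calc |z0| * ‖crossLin U Vv‖ ≤ 1 * (‖U‖ * ‖Vv‖) := by gcongr; exact norm_crossLin_le U Vv
      _ = ‖U‖ * ‖Vv‖ := one_mul _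
  have t5 : ‖u0 • crossLin Vv Z‖ ≤ ‖Vv‖ * ‖Z‖ := by
    rw [norm_smul, Real.norm_eq_abs]
    calc |u0| * ‖crossLin Vv Z‖ ≤ 1 * (‖Vv‖ * ‖Z‖) := by gcongr; exact norm_crossLin_le Vv Z
      _ = ‖Vv‖ * ‖Z‖ := one_mul _
  have t6 : ‖v0 • crossLin U Z‖ ≤ ‖U‖ * ‖Z‖ := by
    rw [norm_smul, Real.norm_eq_abs]
    calc |v0| * ‖crossLin U Z‖ ≤ 1 * (‖U‖ * ‖Z‖) := by gcongr; exact norm_crossLin_le U Z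
      _ = ‖U‖ * ‖Z‖ := one_mul _
  have t7 : ‖⟪U, Vv⟫ • Z‖ ≤ ‖U‖ * ‖Vv‖ * ‖Z‖ := by
    rw [norm_smul, Real.norm_eq_abs]
    exact mul_le_mul_of_nonneg_right (abs_real_inner_le_norm U Vv) hZ0
  have t8 : ‖⟪Z, Vv⟫ • U‖ ≤ ‖Z‖ * ‖Vv‖ * ‖U‖ := by
    rw [norm_smul, Real.norm_eq_abs]
    exact mul_le_mul_of_nonneg_right (abs_real_inner_le_norm Z Vv) hU0
  have t9 : ‖⟪Z, U⟫ • Vv‖ ≤ ‖Z‖ * ‖U‖ * ‖Vv‖ := by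
    rw [norm_smul, Real.norm_eq_abs]
    exact mul_le_mul_of_nonneg_right (abs_real_inner_le_norm Z U) hV00
  have hsum := norm_sub_le_of_le (norm_add_le_of_le (norm_add_le_of_le (norm_add_le_of_le (norm_add_le_of_le
    (norm_sub_le_of_le (norm_add_le_of_le (norm_sub_le_of_le t1 t2) t3) t4) t5) t6) t7) t8) t9
  refine hsum.trans ?_
  -- `(u²+v²)z + (z²+v²)u + v + uv + vz + uz + 3uvz ≤ 2(ε²+ε₁²)ε + ε₁ + 2ε₁ε + ε² + 3ε²ε₁ ≤ 6(ε² + ε₁)`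
  have huv : ‖U‖ * ‖Vv‖ ≤ ε * ε₁ := mul_le_mul hu hv hV00 hε
  have hvz : ‖Vv‖ * ‖Z‖ ≤ ε₁ * ε := mul_le_mul hv hz hZ0 hε₁
  have huz : ‖U‖ * ‖Z‖ ≤ ε * ε := mul_le_mul hu hz hZ0 hε
  have hu2 : ‖U‖ ^ 2 ≤ ε ^ 2 := pow_le_pow_left₀ hU0 hu 2
  have hz2 : ‖Z‖ ^ 2 ≤ ε ^ 2 := pow_le_pow_left₀ hZ0 hz 2
  have hv2 : ‖Vv‖ ^ 2 ≤ ε₁ ^ 2 := pow_le_pow_left₀ hV00 hv 2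
  have hA1 : (‖U‖ ^ 2 + ‖Vv‖ ^ 2) * ‖Z‖ ≤ (ε ^ 2 + ε₁ ^ 2) * ε := mul_le_mul (add_le_add hu2 hv2) hz hZ0 (by positivity)
  have hA2 : (‖Z‖ ^ 2 + ‖Vv‖ ^ 2) * ‖U‖ ≤ (ε ^ 2 + ε₁ ^ 2) * ε := mul_le_mul (add_le_add hz2 hv2) hu hU0 (by positivity)
  have hA3 : ‖U‖ * ‖Vv‖ * ‖Z‖ ≤ ε * ε₁ * ε := mul_le_mul huv hz hZ0 (by positivity)
  have hA4 : ‖Z‖ * ‖Vv‖ * ‖U‖ ≤ ε * ε₁ * ε := by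
    calc ‖Z‖ * ‖Vv‖ * ‖U‖ = ‖U‖ * ‖Vv‖ * ‖Z‖ := by ring
      _ ≤ ε * ε₁ * ε := hA3
  have hA5 : ‖Z‖ * ‖U‖ * ‖Vv‖ ≤ ε * ε₁ * ε := by
    calc ‖Z‖ * ‖U‖ * ‖Vv‖ = ‖U‖ * ‖Vv‖ * ‖Z‖ := by ring
      _ ≤ ε * ε₁ * ε := hA3
  nlinarith

/-! ## (lap-2): `∂*` has at most four terms, and Lemma (r-lemma-one) -/

/-- (lap-2) «`(∂*r⃗)(x) = −r⃗(x,x+e₀) − r⃗(x,x+e₁) + r⃗(x−e₀,x) + r⃗(x−e₁,x)`, possibly with some terms omitted if `x` is close to the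
boundary»: hence `|(∂*g)(x)| ≤ 4 sup_b |g(b)|`. [cite: DybalskiStottmeisterTanimoto2024, §4.6 (lap-2)] -/
theorem norm_delStar_le_four_mul {E : Type*} [SeminormedAddCommGroup E] (g : Bond L n₁ → E) {M : ℝ} (hM0 : 0 ≤ M)
    (hM : ∀ b, ‖g b‖ ≤ M) (x : Site L n₁) : ‖delStar g x‖ ≤ 4 * M := by
  have key : ∀ p : Bond L n₁ → Site L n₁, (Finset.univ.filter fun b : Bond L n₁ => p b = x).card ≤ 2 →
      ‖∑ b ∈ Finset.univ.filter (fun b : Bond L n₁ => p b = x), g b‖ ≤ 2 * M := by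
    intro p hcard
    refine (norm_sum_le _ _).trans ?_
    calc ∑ b ∈ Finset.univ.filter (fun b : Bond L n₁ => p b = x), ‖g b‖
        ≤ ∑ b ∈ Finset.univ.filter (fun b : Bond L n₁ => p b = x), M := Finset.sum_le_sum fun b _ => hM b
      _ = ((Finset.univ.filter fun b : Bond L n₁ => p b = x).card : ℝ) * M := by rw [Finset.sum_const, nsmul_eq_mul]
      _ ≤ 2 * M := mul_le_mul_of_nonneg_right (by exact_mod_cast hcard) hM0
  rw [delStar_apply, ← Finset.sum_filter, ← Finset.sum_filter]
  calc ‖(∑ b ∈ Finset.univ.filter (fun b : Bond L n₁ => b.src = x), g b) -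
        ∑ b ∈ Finset.univ.filter (fun b : Bond L n₁ => b.tgt = x), g b‖
      ≤ ‖∑ b ∈ Finset.univ.filter (fun b : Bond L n₁ => b.src = x), g b‖ +
        ‖∑ b ∈ Finset.univ.filter (fun b : Bond L n₁ => b.tgt = x), g b‖ := norm_sub_le _ _
    _ ≤ 2 * M + 2 * M := add_le_add (key Bond.src (card_src_fiber_le x)) (key Bond.tgt (card_tgt_fiber_le x))
    _ = 4 * M := by ring

/-- **Lemma (r-lemma-one).** «Suppose that `|V⃗(b)| ≤ ε₁`, `A⃗ ∈ Conf⃗^ε(Ω)`, `δ = 1` and `0 ≤ ε, ε₁ ≤ 1/2`.  Then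
`‖∂*r⃗‖_{∞;Ω} ≤ 24(ε² + ε₁)`.» [cite: DybalskiStottmeisterTanimoto2024, §4.6 Lemma (r-lemma-one)] -/
theorem r_lemma_one {ε ε₁ : ℝ} (hε : 0 ≤ ε) (hε' : ε ≤ 1 / 2) (hε₁ : 0 ≤ ε₁) (hε₁' : ε₁ ≤ 1 / 2) {U' : Conf L n₁}
    (hA : ∀ x, ‖Avec U' x‖ ≤ ε) (hδ : ∀ x, 0 ≤ (U' x).val.re) {V : CConf n₁} (hV : ∀ b : Bond L n₁, ‖vecOf (pdV V b)‖ ≤ ε₁)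
    (hV0 : ∀ b : Bond L n₁, 0 ≤ (pdV V b).re) (x : Site L n₁) : ‖delStar (rvec U' V) x‖ ≤ 24 * (ε ^ 2 + ε₁) := by
  have h := norm_delStar_le_four_mul (rvec U' V) (M := 6 * (ε ^ 2 + ε₁)) (by positivity)
    (norm_rvec_le hε hε' hε₁ hε₁' hA hδ hV hV0) x
  linarith

end

end Literature.MathematicalPhysics.QuantumFieldTheory.DybalskiStottmeisterTanimoto2024.DST24RemainderBounds
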